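import Mathlib.Data.Nat.Choose.Sum
import Mathlib.Data.Finset.Powerset
import Mathlib.Data.Fintype.Powerset
import Mathlib.Data.Fintype.Pi
import Mathlib.Algebra.Order.BigOperators.Group.Finset
import Mathlib.Tactic.Ring
import HarnessLib

/-!
# Hamming balls of radius `M/4` are exponentially small

Topic `Computability/Complexity`. The entropy estimate `∑_{i ≤ δM} C(M, i) ≤ 2^{H₂(δ) M}` at `δ = 1/4`
in a form with natural numbers only, and the resulting bound on the number of Boolean functions close
to a given one — the "`K(f ⊕ h) ≤ 2ⁿ·H₂(δ) + O(log n)`" step of Hirahara's Lemma 8.1 (ECCC TR22-119,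
eq. (10), p. 26: a function `δ`-close to a described one is described by the positions of the
disagreements), as consumed by the counting form of the soundness proof of Lemma 8.3.

* `three_pow_mul_sum_choose_le` — `3^{M - M/4} · ∑_{i ≤ M/4} C(M, i) ≤ 4^M` (binomial theorem:
  `4^M = ∑ᵢ C(M,i) 3^{M-i}`), i.e. `∑_{i ≤ M/4} C(M,i) ≤ 2^{2M}/3^{3M/4} ≤ 2^{0.82 M}`;
* `card_filter_near_le` — the functions `f : V → Bool` differing from a fixed `c` on at most `r`
  points number at most `∑_{i ≤ r} C(|V|, i)` (inject `f ↦ {v | f v ≠ c v}`);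
* `card_filter_exists_near_mul_le` — for a finite family of centres `c_a` (`a ∈ A`):
  `#{f | ∃ a, #{f ≠ c_a} ≤ |V|/4} · 3^{|V| - |V|/4} ≤ |A| · 4^{|V|}`.

## References

* S. Hirahara, *NP-hardness of learning programs and partial MCSP*, ECCC TR22-119, proof of Lemma 8.1,
  eq. (10) (p. 26) [Hirahara2022PartialMCSP].
-/

namespace Literature.Computability.Complexity

open Finset

namespace HammingBall

/-- **`3^{M - M/4} · ∑_{i ≤ M/4} C(M, i) ≤ 4^M`** (from `4^M = (3+1)^M = ∑ᵢ C(M,i) 3^{M-i}` and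
`3^{M-i} ≥ 3^{M-M/4}` for `i ≤ M/4`). [cite: Hirahara2022PartialMCSP, proof of Lemma 8.1, eq. (10) (log ∑_{i ≤ δ2ⁿ} C(2ⁿ,i) ≤ 2ⁿ H₂(δ))] -/
theorem three_pow_mul_sum_choose_le (M : ℕ) :
    3 ^ (M - M / 4) * ∑ i ∈ range (M / 4 + 1), M.choose i ≤ 4 ^ M := by
  have hbin : (4 : ℕ) ^ M = ∑ i ∈ range (M + 1), 3 ^ (M - i) * M.choose i := by
    have h := add_pow (1 : ℕ) 3 M  -- (1 + 3)^M = ∑ 1^i 3^(M-i) C(M,i)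
    simp only [one_pow, one_mul] at h
    simpa using h
  rw [hbin, Finset.mul_sum]
  calc ∑ i ∈ range (M / 4 + 1), 3 ^ (M - M / 4) * M.choose i
      ≤ ∑ i ∈ range (M / 4 + 1), 3 ^ (M - i) * M.choose i := sum_le_sum fun i hi => by
          rw [mem_range] at hi
          exact Nat.mul_le_mul_right _ (Nat.pow_le_pow_right (by norm_num)
            (Nat.sub_le_sub_left (Nat.le_of_lt_succ hi) M))
    _ ≤ ∑ i ∈ range (M + 1), 3 ^ (M - i) * M.choose i :=
        sum_le_sum_of_subset_of_nonneg
          (fun i hi => mem_range.2 ((mem_range.1 hi).trans_le (Nat.succ_le_succ (Nat.div_le_self M 4))))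
          fun _ _ _ => Nat.zero_le _

variable {V : Type} [Fintype V] [DecidableEq V]

/-- The functions differing from `c` on at most `r` points number at most `∑_{i ≤ r} C(|V|, i)`.
[cite: Hirahara2022PartialMCSP, proof of Lemma 8.1, eq. (10) (describing f ⊕ h by its support)] -/
theorem card_filter_near_le (c : V → Bool) (r : ℕ) :
    ((univ : Finset (V → Bool)).filter fun f => (univ.filter fun v => f v ≠ c v).card ≤ r).card ≤
      ∑ i ∈ range (r + 1), (Fintype.card V).choose i := by
  classical
  -- inject `f ↦ its disagreement set`
  have hinj : Set.InjOn (fun f : V → Bool => univ.filter fun v => f v ≠ c v)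
      ((univ : Finset (V → Bool)).filter fun f => (univ.filter fun v => f v ≠ c v).card ≤ r) := by
    intro f _ f' _ hff'
    funext v
    have h := congrArg (fun S : Finset V => v ∈ S) hff'
    simp only [mem_filter, mem_univ, true_and, eq_iff_iff] at h
    cases hf : f v <;> cases hf' : f' v <;> cases hc : c v <;> simp_all
  have hmaps : Set.MapsTo (fun f : V → Bool => univ.filter fun v => f v ≠ c v)
      ((univ : Finset (V → Bool)).filter fun f => (univ.filter fun v => f v ≠ c v).card ≤ r)
      ((range (r + 1)).biUnion fun i => (univ : Finset V).powersetCard i) := by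
    intro f hf
    have hf' := (mem_filter.1 (Finset.mem_coe.1 hf)).2
    rw [Finset.mem_coe, mem_biUnion]
    exact ⟨_, mem_range.2 (Nat.lt_succ_of_le hf'), mem_powersetCard.2 ⟨subset_univ _, rfl⟩⟩
  calc ((univ : Finset (V → Bool)).filter fun f => (univ.filter fun v => f v ≠ c v).card ≤ r).card
      ≤ ((range (r + 1)).biUnion fun i => (univ : Finset V).powersetCard i).card :=
        card_le_card_of_injOn _ hmaps hinj
    _ ≤ ∑ i ∈ range (r + 1), ((univ : Finset V).powersetCard i).card := card_biUnion_le
    _ = ∑ i ∈ range (r + 1), (Fintype.card V).choose i := by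
        refine sum_congr rfl fun i _ => ?_
        rw [card_powersetCard, card_univ]

/-- **Few functions are `1/4`-close to one of few centres**:
`#{f | ∃ a, #{v | f v ≠ c_a v} ≤ |V|/4} · 3^{|V| - |V|/4} ≤ |A| · 4^{|V|}`.
[cite: Hirahara2022PartialMCSP, proof of Lemma 8.1 (list-decodability: K(f) ≤ K_δ(f) + 2ⁿH₂(δ) + O(n))] -/
theorem card_filter_exists_near_mul_le {A : Type} [Fintype A] (c : A → V → Bool) :
    ((univ : Finset (V → Bool)).filter fun f =>
        ∃ a, (univ.filter fun v => f v ≠ c a v).card ≤ Fintype.card V / 4).card *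
          3 ^ (Fintype.card V - Fintype.card V / 4) ≤
      Fintype.card A * 4 ^ Fintype.card V := by
  classical
  set M := Fintype.card V with hM
  have hunion : ((univ : Finset (V → Bool)).filter fun f =>
      ∃ a, (univ.filter fun v => f v ≠ c a v).card ≤ M / 4).card ≤
      ∑ a : A, ((univ : Finset (V → Bool)).filter fun f => (univ.filter fun v => f v ≠ c a v).card ≤ M / 4).card := by
    calc ((univ : Finset (V → Bool)).filter fun f => ∃ a, (univ.filter fun v => f v ≠ c a v).card ≤ M / 4).card
        = ∑ f : V → Bool, if ∃ a, (univ.filter fun v => f v ≠ c a v).card ≤ M / 4 then 1 else 0 := by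
          rw [Finset.sum_boole]; simp
      _ ≤ ∑ f : V → Bool, ∑ a : A, if (univ.filter fun v => f v ≠ c a v).card ≤ M / 4 then 1 else 0 :=
          sum_le_sum fun f _ => by
            split_ifs with h
            · obtain ⟨a, ha⟩ := h
              calc (1 : ℕ) = if (univ.filter fun v => f v ≠ c a v).card ≤ M / 4 then 1 else 0 := by rw [if_pos ha]
                _ ≤ ∑ a : A, if (univ.filter fun v => f v ≠ c a v).card ≤ M / 4 then 1 else 0 :=
                    Finset.single_le_sum (f := fun a => if (univ.filter fun v => f v ≠ c a v).card ≤ M / 4 then 1 else 0)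
                      (fun _ _ => Nat.zero_le _) (mem_univ a)
            · exact Nat.zero_le _
      _ = ∑ a : A, ((univ : Finset (V → Bool)).filter fun f => (univ.filter fun v => f v ≠ c a v).card ≤ M / 4).card := by
          rw [Finset.sum_comm]
          refine sum_congr rfl fun a _ => ?_
          rw [Finset.sum_boole]; simp
  calc _ ≤ (∑ a : A, ((univ : Finset (V → Bool)).filter fun f =>
          (univ.filter fun v => f v ≠ c a v).card ≤ M / 4).card) * 3 ^ (M - M / 4) :=
        Nat.mul_le_mul_right _ hunion
    _ ≤ (∑ _a : A, ∑ i ∈ range (M / 4 + 1), M.choose i) * 3 ^ (M - M / 4) :=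
        Nat.mul_le_mul_right _ (sum_le_sum fun a _ => card_filter_near_le (c a) _)
    _ = Fintype.card A * (3 ^ (M - M / 4) * ∑ i ∈ range (M / 4 + 1), M.choose i) := by
        rw [sum_const, card_univ, nsmul_eq_mul, Nat.cast_id]; ring
    _ ≤ Fintype.card A * 4 ^ M := Nat.mul_le_mul_left _ (three_pow_mul_sum_choose_le M)

end HammingBall

end Literature.Computability.Complexity
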